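/-
Copyright (c) 2026 the pub-hodgecm-mathlib formalisation cell (harness21).  Prover seat hodgecm-mathlib-LH4-p13 (g7), req620 Track A «(D-RAM) FOUR-FRAME» squad, tier 0,
STAGE-1b PRE-SCOPING (heir LEAD F0P3a-plan (g20) T19-24 «allowed as scoping»): organ (L-lab) «THE LABEL LAW» of the rows `stub_rows_transvPlus ∕ stub_rows_transvMinus`
— brick (L-lab-1) «THE ONE-SLOT LABEL LAW»: at a one-slot-dominant vertex the label of a frame element is the label of a SCALAR MULTIPLE OF THE REFERENCE NILPOTENT.  2026-09-04.
-/
import Summits.HodgeConjecture.HodgeConjecture.Theorems.F0P3cDyRamFrameEltValueSet      -- ★ p858717 (this seat, (L-lab-0)): `latticeValueSetMod_frameElt_sub_one`, `valueSetMod_xPlus`; brings ★ CensusDefs, ★ №3, ★ frame lit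
import Summits.HodgeConjecture.HodgeConjecture.Theorems.F0P3cDyRamTableDiagWitnesses    -- ★ (LH4-p03): `pairing_smul_xPlus_mulVec` (`⟨y, (ε•X₊)y⟩ = ε·t₊·(y₂·σy₂)`), `not_labelPlus_smul_xPlus`
import HarnessLib

/-!
# Crux `H413`, line LH4 «(D-RAM) FOUR-FRAME», tier 0, STAGE-1b pre-scoping — (L-lab-1): THE ONE-SLOT LABEL LAW for a frame element at a vertex

Cell `hodgecm-mathlib` (D-0151), FLOOR 0, crux item H413 = `stmt-HodgeConjecture-24833`, route of record `HCCMUnconditional`; squad F0∕P3c∕LH4.  SCOPING INVENTORY for the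
LEAD's PLAN-T1 v19 (L-lab) paragraph (the OPEN tier-0 rows `stub_rows_transvPlus ∕ stub_rows_transvMinus` have NO directive yet, T19-21∕T19-24); THEOREMS ONLY (no `def`,
no instance, no notation, no `sorry`, default heartbeats), ★-only imports, lane `--supports stmt-HodgeConjecture-24833 --as helper`; pays NO row, states NO law.

THE MATHEMATICS (sequel of ★ (L-lab-0) p858717).  `σ` an involution of the valued field `K`, `Φ₃` the antidiagonal form, `⟨·,·⟩` its `σ`-sesquilinear pairing, `γ_b =
frameElt σ f b α β`, `N_i = ⟨f b i, f b i⟩`, `s_i(y) = ⟨f b i, y⟩`, `N(s) = s·σs`, `t₊ = (ϖ − σϖ)·((ϖσϖ)^{⌊d∕2⌋})⁻¹` the coefficient of ★ `xPlus σ ϖ d = t₊·E₀₂`.  By ★ (L-lab-0) the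
value set of `γ_b − 1` at a lattice `M` is the `ϖ^m`-thickening of `{(α−1)N₀⁻¹N(s₀ y) + (β−1)N₁⁻¹N(s₁ y) | y ∈ M}`.
* §1 **ABSORPTION** (`latticeValueSetMod_frameElt_sub_one_of_snd_small` ∕ `…_of_fst_small`): if the second slot is `ϖ^m`-NEGLIGIBLE on `M` (`|(ϖ^m)⁻¹·(β−1)N₁⁻¹N(s₁ y)| ≤ 1`
  for all `y ∈ M`), the value set is the thickening of the FIRST slot alone `{(α−1)N₀⁻¹N(s₀ y) | y ∈ M}` (ultrametric inequality); symmetrically for the first slot.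
* §2 **PRINCIPAL FUNCTIONAL IMAGE** (`setOf_slot_eq_valueSetMod_smul_xPlus`): if the functional image `{⟨g, y⟩ | y ∈ M}` of `M` under a vector `g` is the principal module
  `s⋆·𝒪`, then for every coefficient `c` and every scalar `e` with `e·t₊ = c·N(s⋆)` the one-slot set `{c·N(⟨g,y⟩) | y ∈ M} + ϖ^m𝒪` IS the value set
  `valueSetMod σ ϖ m (e • xPlus σ ϖ d)` of the SCALAR MULTIPLE `e·X₊` of the reference nilpotent (★ `pairing_smul_xPlus_mulVec`; witnesses `y ↦ r = ⟨g,y⟩∕s⋆` and `a ↦ (0,0,a)`).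
* §3 **THE ONE-SLOT LABEL LAW** (`latticeLabelPlus_frameElt_sub_one_iff_labelPlus_smul`): under §1's negligibility and §2's principality (at `g = f b 0`, `c = (α−1)N₀⁻¹`),
  `LatticeLabelPlus σ ϖ d m M (γ_b − 1) ⟺ LabelPlus σ ϖ d m (e • xPlus σ ϖ d)` for ANY `e` with `e·t₊ = (α−1)·N₀⁻¹·N(s⋆)` — so the ★ UNIPOTENT label apparatus of unit U4
  (★ `not_labelPlus_smul_xPlus`: a `σ`-fixed NON-NORM unit `ε` gives `¬LabelPlus (ε•X₊)` at `m* = d%2 + 2d − 1`; §4 below: a NORM unit gives `LabelPlus`) transfers verbatim to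
  ELLIPTIC frame elements at one-slot-dominant vertices, and the frame index `b` enters through `N₀ = N(f b 0)`, whose norm class is `(signPair b).1 = κ₁(b)` (★ H4∕H7) —
  LH4-p08 (g7)'s scoping hypothesis (O2) «signed shell difference at frame `b` = `κ_i(b)` × difference at `b₀`» in theorem form for the one-slot layers.  (`…_of_fst_small`: the
  mirror statement for the second slot, `κ₂(b)`.)
* §4 **SCALAR CALCULUS FOR `e • X₊`** (what the consumer needs to finish): `valueSetMod_smul_xPlus_mul_norm` (the value set of `e•X₊` depends on `e` only modulo NORMS OF UNITS
  `u·σu`; any `σ`), `labelPlus_norm_smul_xPlus` (`LabelPlus σ ϖ d m ((u·σu) • X₊)` for a unit `u`), `valueSetMod_smul_xPlus_congr` (the value set at level `m` depends on `e·t₊` only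
  modulo `ϖ^m`: the bridge from the non-`σ`-fixed `e` of §3 — `σe = e∕α` — to a `σ`-fixed representative when `α ≡ 1` deep enough, which the shell condition supplies).
HONEST LABEL.  Count-neutral scoping brick; the three tier-0 rows stay OPEN; `HC_CM` is proved only modulo the 7 printed citations (2 remaining named inputs: hLiu418 =
`stmt-HodgeConjecture-24832`, h413 = `stmt-HodgeConjecture-24833`) until rung 0 closes.

## References
* [Rogawski1990] J. D. Rogawski, *Automorphic Representations of Unitary Groups in Three Variables*, Ann. of Math. Stud. 123 (1990), §4.9 Prop. 4.9.1 (a)(b) p. 55.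
* [Kottwitz1986] R. E. Kottwitz, *Stable trace formula: elliptic singular terms*, Math. Ann. 275 (1986), §3 (fixed lattices of a semisimple element on the building).
* [LanglandsShelstad1987] R. P. Langlands, D. Shelstad, *On the definition of transfer factors*, Math. Ann. 278 (1987), §3 (the κ-signs of the four frames).
* [Serre1979] J.-P. Serre, *Local Fields*, GTM 67 (1979), Ch. V §3 Cor. 3 (norm classes of units; conductor).
-/

set_option autoImplicit false

noncomputable section

namespace Summit.HodgeConjecture.HodgeConjecture.Cruxes.H413.F0P3cDyRamFrameEltOneSlotLabel

open Literature.NumberTheory.Automorphic Literature.NumberTheory.Automorphic.HermitianLattice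
open Literature.NumberTheory.Automorphic.UnitaryLatticeTree Literature.NumberTheory.Automorphic.UnitaryThreeFourFrame
open Summit.HodgeConjecture.HodgeConjecture.Cruxes.H413.F0P3cDyRamFourFramePieces
open Summit.HodgeConjecture.HodgeConjecture.Cruxes.H413.F0P3cDyRamFourFrameCensusDefs
open Summit.HodgeConjecture.HodgeConjecture.Cruxes.H413.F0P3cDyRamFrameEltValueSet (latticeValueSetMod_frameElt_sub_one valueSetMod_xPlus)
open Summit.HodgeConjecture.HodgeConjecture.Cruxes.H413.F0P3cDyRamTableDiagWitnesses (pairing_smul_xPlus_mulVec)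
open scoped Matrix Valued WithZero

variable {K : Type} [Field K] [Valued K ℤᵐ⁰]

/-! ## §1  Absorption: a `ϖ^m`-negligible slot drops out of the value set -/

/-- **ABSORPTION OF A NEGLIGIBLE SECOND SLOT.**  If `|(ϖ^m)⁻¹·(β−1)·N₁⁻¹·N(⟨f b 1, y⟩)| ≤ 1` for every `y ∈ M`, then the value set of `γ_b − 1` at `M` is the `ϖ^m`-thickening of the
first slot `{(α−1)·N₀⁻¹·N(⟨f b 0, y⟩) | y ∈ M}` alone (ultrametric inequality over ★ (L-lab-0) `latticeValueSetMod_frameElt_sub_one`). [cite: Kottwitz1986, §3] -/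
theorem latticeValueSetMod_frameElt_sub_one_of_snd_small {σ : K →+* K} (hσσ : ∀ a, σ (σ a) = a) (ϖ : K) (m : ℕ) (M : Submodule 𝒪[K] (Fin 3 → K))
    (f : Fin 4 → Fin 3 → (Fin 3 → K)) (b : Fin 4) (α β : K)
    (hsmall : ∀ y ∈ M, Valued.v ((ϖ ^ m)⁻¹ * ((β - 1) * ((pairing σ ((StdForm.antidiagonal 3).over K) (f b 1) (f b 1))⁻¹ *
      (pairing σ ((StdForm.antidiagonal 3).over K) (f b 1) y * σ (pairing σ ((StdForm.antidiagonal 3).over K) (f b 1) y))))) ≤ 1) :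
    latticeValueSetMod σ ϖ m M (frameElt σ f b α β - 1) =
      {z | ∃ y ∈ M, Valued.v ((ϖ ^ m)⁻¹ * (z - (α - 1) * (pairing σ ((StdForm.antidiagonal 3).over K) (f b 0) (f b 0))⁻¹ *
        (pairing σ ((StdForm.antidiagonal 3).over K) (f b 0) y * σ (pairing σ ((StdForm.antidiagonal 3).over K) (f b 0) y)))) ≤ 1} := by
  rw [latticeValueSetMod_frameElt_sub_one hσσ]
  ext z
  simp only [Set.mem_setOf_eq]
  constructor
  · rintro ⟨y, hy, hz⟩
    refine ⟨y, hy, ?_⟩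
    have hB := hsmall y hy
    have key := Valuation.map_add_le _ hz hB
    convert key using 2
    ring
  · rintro ⟨y, hy, hz⟩
    refine ⟨y, hy, ?_⟩
    have hB := hsmall y hy
    have key := Valuation.map_sub_le _ hz hB
    convert key using 2
    ring

/-- **ABSORPTION OF A NEGLIGIBLE FIRST SLOT** (mirror of the previous): if `|(ϖ^m)⁻¹·(α−1)·N₀⁻¹·N(⟨f b 0, y⟩)| ≤ 1` on `M`, the value set of `γ_b − 1` at `M` is the thickening
of the second slot `{(β−1)·N₁⁻¹·N(⟨f b 1, y⟩) | y ∈ M}`. [cite: Kottwitz1986, §3] -/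
theorem latticeValueSetMod_frameElt_sub_one_of_fst_small {σ : K →+* K} (hσσ : ∀ a, σ (σ a) = a) (ϖ : K) (m : ℕ) (M : Submodule 𝒪[K] (Fin 3 → K))
    (f : Fin 4 → Fin 3 → (Fin 3 → K)) (b : Fin 4) (α β : K)
    (hsmall : ∀ y ∈ M, Valued.v ((ϖ ^ m)⁻¹ * ((α - 1) * ((pairing σ ((StdForm.antidiagonal 3).over K) (f b 0) (f b 0))⁻¹ *
      (pairing σ ((StdForm.antidiagonal 3).over K) (f b 0) y * σ (pairing σ ((StdForm.antidiagonal 3).over K) (f b 0) y))))) ≤ 1) :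
    latticeValueSetMod σ ϖ m M (frameElt σ f b α β - 1) =
      {z | ∃ y ∈ M, Valued.v ((ϖ ^ m)⁻¹ * (z - (β - 1) * (pairing σ ((StdForm.antidiagonal 3).over K) (f b 1) (f b 1))⁻¹ *
        (pairing σ ((StdForm.antidiagonal 3).over K) (f b 1) y * σ (pairing σ ((StdForm.antidiagonal 3).over K) (f b 1) y)))) ≤ 1} := by
  rw [latticeValueSetMod_frameElt_sub_one hσσ]
  ext z
  simp only [Set.mem_setOf_eq]
  constructor
  · rintro ⟨y, hy, hz⟩
    refine ⟨y, hy, ?_⟩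
    have hA := hsmall y hy
    have key := Valuation.map_add_le _ hz hA
    convert key using 2
    ring
  · rintro ⟨y, hy, hz⟩
    refine ⟨y, hy, ?_⟩
    have hA := hsmall y hy
    have key := Valuation.map_sub_le _ hz hA
    convert key using 2
    ring

/-! ## §2  A principal functional image turns a one-slot set into the value set of `e • X₊` -/

/-- **PRINCIPAL FUNCTIONAL IMAGE.**  If the functional image of `M` under `⟨g, ·⟩` is the principal module `s⋆·𝒪` (`∀ z, (∃ y ∈ M, ⟨g, y⟩ = z) ↔ ∃ r, |r| ≤ 1 ∧ z = s⋆·r`),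
then for every coefficient `c` and every scalar `e` with `e·t₊ = c·N(s⋆)` the thickened one-slot set `{c·N(⟨g, y⟩) | y ∈ M} + ϖ^m𝒪` equals `valueSetMod σ ϖ m (e • xPlus σ ϖ d)`
(★ `⟨y, (e•X₊)y⟩ = e·t₊·N(y₂)`; witnesses `r = ⟨g,y⟩∕s⋆` and `y = (0,0,a)`). [cite: Rogawski1990, §4.9 Prop. 4.9.1 (b) p. 55] [cite: Kottwitz1986, §3] -/
theorem setOf_slot_eq_valueSetMod_smul_xPlus (σ : K →+* K) (ϖ : K) (d m : ℕ) (M : Submodule 𝒪[K] (Fin 3 → K)) (g : Fin 3 → K) (c sStar e : K)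
    (hgen : ∀ z : K, (∃ y ∈ M, pairing σ ((StdForm.antidiagonal 3).over K) g y = z) ↔ ∃ r : K, Valued.v r ≤ 1 ∧ z = sStar * r)
    (he : e * ((ϖ - σ ϖ) * ((ϖ * σ ϖ) ^ ((d - d % 2) / 2))⁻¹) = c * (sStar * σ sStar)) :
    {z | ∃ y ∈ M, Valued.v ((ϖ ^ m)⁻¹ * (z - c * (pairing σ ((StdForm.antidiagonal 3).over K) g y * σ (pairing σ ((StdForm.antidiagonal 3).over K) g y)))) ≤ 1} =
      valueSetMod σ ϖ m (e • xPlus σ ϖ d) := by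
  ext z
  simp only [valueSetMod, Set.mem_setOf_eq]
  constructor
  · rintro ⟨y, hy, hz⟩
    obtain ⟨r, hr, hgr⟩ := (hgen _).1 ⟨y, hy, rfl⟩
    refine ⟨![0, 0, r], fun i => ?_, ?_⟩
    · fin_cases i
      · simp
      · simp
      · simpa using hr
    · rw [pairing_smul_xPlus_mulVec]
      have h3 : (![0, 0, r] : Fin 3 → K) 2 = r := rfl
      have hval : e * ((ϖ - σ ϖ) * ((ϖ * σ ϖ) ^ ((d - d % 2) / 2))⁻¹ * (r * σ r)) =
          c * (pairing σ ((StdForm.antidiagonal 3).over K) g y * σ (pairing σ ((StdForm.antidiagonal 3).over K) g y)) := by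
        rw [hgr, map_mul]
        linear_combination (r * σ r) * he
      rw [h3, hval]
      exact hz
  · rintro ⟨y, hy, hz⟩
    obtain ⟨x, hx, hgx⟩ := (hgen _).2 ⟨y 2, hy 2, rfl⟩
    refine ⟨x, hx, ?_⟩
    rw [pairing_smul_xPlus_mulVec] at hz
    have hval : c * (pairing σ ((StdForm.antidiagonal 3).over K) g x * σ (pairing σ ((StdForm.antidiagonal 3).over K) g x)) =
        e * ((ϖ - σ ϖ) * ((ϖ * σ ϖ) ^ ((d - d % 2) / 2))⁻¹ * (y 2 * σ (y 2))) := by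
      rw [hgx, map_mul]
      linear_combination -((y 2 * σ (y 2)) * he)
    rw [hval]
    exact hz

/-! ## §3  The one-slot label law -/

/-- **THE ONE-SLOT LABEL LAW (first slot dominant).**  At a lattice `M` where the second slot of `γ_b − 1` is `ϖ^m`-negligible and the first functional image
`{⟨f b 0, y⟩ | y ∈ M}` is principal `= s⋆·𝒪`, for every scalar `e` with `e·t₊ = (α − 1)·N₀⁻¹·N(s⋆)`:
`LatticeLabelPlus σ ϖ d m M (γ_b − 1) ⟺ LabelPlus σ ϖ d m (e • xPlus σ ϖ d)` — the vertex label of the ELLIPTIC frame element is the label of the SCALAR MULTIPLE `e·X₊` of the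
reference transvection nilpotent, so unit U4's ★ unipotent label lemmas apply verbatim; the frame index enters through `N₀ = N(f b 0)` (norm class `(signPair b).1 = κ₁(b)`).
[cite: Rogawski1990, §4.9 Prop. 4.9.1 (b) p. 55] [cite: LanglandsShelstad1987, §3] [cite: Kottwitz1986, §3] -/
theorem latticeLabelPlus_frameElt_sub_one_iff_labelPlus_smul {σ : K →+* K} (hσσ : ∀ a, σ (σ a) = a) (ϖ : K) (d m : ℕ) (M : Submodule 𝒪[K] (Fin 3 → K))
    (f : Fin 4 → Fin 3 → (Fin 3 → K)) (b : Fin 4) (α β : K) {sStar e : K}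
    (hsmall : ∀ y ∈ M, Valued.v ((ϖ ^ m)⁻¹ * ((β - 1) * ((pairing σ ((StdForm.antidiagonal 3).over K) (f b 1) (f b 1))⁻¹ *
      (pairing σ ((StdForm.antidiagonal 3).over K) (f b 1) y * σ (pairing σ ((StdForm.antidiagonal 3).over K) (f b 1) y))))) ≤ 1)
    (hgen : ∀ z : K, (∃ y ∈ M, pairing σ ((StdForm.antidiagonal 3).over K) (f b 0) y = z) ↔ ∃ r : K, Valued.v r ≤ 1 ∧ z = sStar * r)
    (he : e * ((ϖ - σ ϖ) * ((ϖ * σ ϖ) ^ ((d - d % 2) / 2))⁻¹) =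
      (α - 1) * (pairing σ ((StdForm.antidiagonal 3).over K) (f b 0) (f b 0))⁻¹ * (sStar * σ sStar)) :
    LatticeLabelPlus σ ϖ d m M (frameElt σ f b α β - 1) ↔ LabelPlus σ ϖ d m (e • xPlus σ ϖ d) := by
  rw [LatticeLabelPlus, LabelPlus, latticeValueSetMod_frameElt_sub_one_of_snd_small hσσ ϖ m M f b α β hsmall,
    setOf_slot_eq_valueSetMod_smul_xPlus σ ϖ d m M (f b 0) ((α - 1) * (pairing σ ((StdForm.antidiagonal 3).over K) (f b 0) (f b 0))⁻¹) sStar e hgen he]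

/-- **THE ONE-SLOT LABEL LAW (second slot dominant)** — the mirror statement: first slot negligible, second functional image principal `= s⋆·𝒪`, `e·t₊ = (β − 1)·N₁⁻¹·N(s⋆)` ⇒
`LatticeLabelPlus σ ϖ d m M (γ_b − 1) ⟺ LabelPlus σ ϖ d m (e • xPlus σ ϖ d)` (frame index through `N₁ = N(f b 1)`, class `(signPair b).2 = κ₂(b)`).
[cite: Rogawski1990, §4.9 Prop. 4.9.1 (b) p. 55] [cite: LanglandsShelstad1987, §3] -/
theorem latticeLabelPlus_frameElt_sub_one_iff_labelPlus_smul_of_fst_small {σ : K →+* K} (hσσ : ∀ a, σ (σ a) = a) (ϖ : K) (d m : ℕ)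
    (M : Submodule 𝒪[K] (Fin 3 → K)) (f : Fin 4 → Fin 3 → (Fin 3 → K)) (b : Fin 4) (α β : K) {sStar e : K}
    (hsmall : ∀ y ∈ M, Valued.v ((ϖ ^ m)⁻¹ * ((α - 1) * ((pairing σ ((StdForm.antidiagonal 3).over K) (f b 0) (f b 0))⁻¹ *
      (pairing σ ((StdForm.antidiagonal 3).over K) (f b 0) y * σ (pairing σ ((StdForm.antidiagonal 3).over K) (f b 0) y))))) ≤ 1)
    (hgen : ∀ z : K, (∃ y ∈ M, pairing σ ((StdForm.antidiagonal 3).over K) (f b 1) y = z) ↔ ∃ r : K, Valued.v r ≤ 1 ∧ z = sStar * r)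
    (he : e * ((ϖ - σ ϖ) * ((ϖ * σ ϖ) ^ ((d - d % 2) / 2))⁻¹) =
      (β - 1) * (pairing σ ((StdForm.antidiagonal 3).over K) (f b 1) (f b 1))⁻¹ * (sStar * σ sStar)) :
    LatticeLabelPlus σ ϖ d m M (frameElt σ f b α β - 1) ↔ LabelPlus σ ϖ d m (e • xPlus σ ϖ d) := by
  rw [LatticeLabelPlus, LabelPlus, latticeValueSetMod_frameElt_sub_one_of_fst_small hσσ ϖ m M f b α β hsmall,
    setOf_slot_eq_valueSetMod_smul_xPlus σ ϖ d m M (f b 1) ((β - 1) * (pairing σ ((StdForm.antidiagonal 3).over K) (f b 1) (f b 1))⁻¹) sStar e hgen he]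

/-! ## §4  Scalar calculus for `e • X₊` -/

/-- **NORM-UNIT INVARIANCE.**  For a unit `u` (any ring endomorphism `σ`): `valueSetMod σ ϖ m ((e·(u·σu)) • X₊) = valueSetMod σ ϖ m (e • X₊)` — the value set of a scalar multiple
of the reference nilpotent depends on the scalar only modulo norms of units (`y₂ ↦ u·y₂` permutes the integral vectors). [cite: Serre1979, Ch. V §3 Cor. 3] -/
theorem valueSetMod_smul_xPlus_mul_norm (σ : K →+* K) (ϖ : K) (d m : ℕ) (e : K) {u : K} (hu : Valued.v u = 1) :
    valueSetMod σ ϖ m ((e * (u * σ u)) • xPlus σ ϖ d) = valueSetMod σ ϖ m (e • xPlus σ ϖ d) := by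
  have hu0 : u ≠ 0 := fun h => by rw [h, map_zero] at hu; exact zero_ne_one hu
  have hσu0 : σ u ≠ 0 := (map_ne_zero σ).2 hu0
  have hvu : ∀ x : K, Valued.v (u * x) = Valued.v x := fun x => by rw [map_mul, hu, one_mul]
  have hvu' : ∀ x : K, Valued.v (u⁻¹ * x) = Valued.v x := fun x => by rw [map_mul, map_inv₀, hu, inv_one, one_mul]
  ext z
  simp only [valueSetMod, Set.mem_setOf_eq]
  constructor
  · rintro ⟨y, hy, hz⟩
    refine ⟨![0, 0, u * y 2], fun i => ?_, ?_⟩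
    · fin_cases i
      · simp
      · simp
      · simpa [hvu] using hy 2
    · rw [pairing_smul_xPlus_mulVec] at hz ⊢
      have h3 : (![0, 0, u * y 2] : Fin 3 → K) 2 = u * y 2 := rfl
      have hval : e * ((ϖ - σ ϖ) * ((ϖ * σ ϖ) ^ ((d - d % 2) / 2))⁻¹ * (u * y 2 * σ (u * y 2))) =
          e * (u * σ u) * ((ϖ - σ ϖ) * ((ϖ * σ ϖ) ^ ((d - d % 2) / 2))⁻¹ * (y 2 * σ (y 2))) := by
        rw [map_mul]; ring
      rw [h3, hval]
      exact hz
  · rintro ⟨y, hy, hz⟩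
    refine ⟨![0, 0, u⁻¹ * y 2], fun i => ?_, ?_⟩
    · fin_cases i
      · simp
      · simp
      · simpa [hvu'] using hy 2
    · rw [pairing_smul_xPlus_mulVec] at hz ⊢
      have h3 : (![0, 0, u⁻¹ * y 2] : Fin 3 → K) 2 = u⁻¹ * y 2 := rfl
      have hval : e * (u * σ u) * ((ϖ - σ ϖ) * ((ϖ * σ ϖ) ^ ((d - d % 2) / 2))⁻¹ * (u⁻¹ * y 2 * σ (u⁻¹ * y 2))) =
          e * ((ϖ - σ ϖ) * ((ϖ * σ ϖ) ^ ((d - d % 2) / 2))⁻¹ * (y 2 * σ (y 2))) := by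
        rw [map_mul, map_inv₀]
        field_simp
      rw [h3, hval]
      exact hz

/-- **A NORM UNIT MULTIPLE OF `X₊` HAS LABEL `+`**: `LabelPlus σ ϖ d m ((u·σu) • xPlus σ ϖ d)` for every unit `u`. [cite: Serre1979, Ch. V §3 Cor. 3] -/
theorem labelPlus_norm_smul_xPlus (σ : K →+* K) (ϖ : K) (d m : ℕ) {u : K} (hu : Valued.v u = 1) :
    LabelPlus σ ϖ d m ((u * σ u) • xPlus σ ϖ d) := by
  rw [LabelPlus, ← one_mul (u * σ u), valueSetMod_smul_xPlus_mul_norm σ ϖ d m 1 hu, one_smul]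

/-- **LEVEL-`m` CONGRUENCE OF THE SCALAR.**  If `|(ϖ^m)⁻¹·((e − e')·t₊)| ≤ 1` then `valueSetMod σ ϖ m (e • X₊) = valueSetMod σ ϖ m (e' • X₊)` (`σ` isometric: `|N(y₂)| ≤ 1` on integral
vectors) — the scalar of §3 is NOT `σ`-fixed (`σe = e∕α`), but its value set at level `m` only reads `e·t₊ mod ϖ^m`, so any `σ`-fixed `e' ≡ e` deep enough may replace it before
★ `not_labelPlus_smul_xPlus` is applied. [cite: Serre1979, Ch. V §3 Cor. 3] -/
theorem valueSetMod_smul_xPlus_congr {σ : K →+* K} (hvσ : ∀ a, Valued.v (σ a) = Valued.v a) (ϖ : K) (d m : ℕ) {e e' : K}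
    (hee : Valued.v ((ϖ ^ m)⁻¹ * ((e - e') * ((ϖ - σ ϖ) * ((ϖ * σ ϖ) ^ ((d - d % 2) / 2))⁻¹))) ≤ 1) :
    valueSetMod σ ϖ m (e • xPlus σ ϖ d) = valueSetMod σ ϖ m (e' • xPlus σ ϖ d) := by
  -- for an integral `y`, the two pairing values differ by `(e − e')·t₊·N(y₂)`, which is `ϖ^m`-small
  have hdiff : ∀ y : Fin 3 → K, (∀ a, Valued.v (y a) ≤ 1) →
      Valued.v ((ϖ ^ m)⁻¹ * ((e - e') * ((ϖ - σ ϖ) * ((ϖ * σ ϖ) ^ ((d - d % 2) / 2))⁻¹) * (y 2 * σ (y 2)))) ≤ 1 := by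
    intro y hy
    have hN : Valued.v (y 2 * σ (y 2)) ≤ 1 := by
      rw [map_mul, hvσ]; exact mul_le_one' (hy 2) (hy 2)
    rw [← mul_assoc, map_mul]
    exact mul_le_one' hee hN
  ext z
  simp only [valueSetMod, Set.mem_setOf_eq]
  constructor
  · rintro ⟨y, hy, hz⟩
    refine ⟨y, hy, ?_⟩
    rw [pairing_smul_xPlus_mulVec] at hz ⊢
    have key := Valuation.map_add_le _ hz (hdiff y hy)
    convert key using 2
    ring
  · rintro ⟨y, hy, hz⟩
    refine ⟨y, hy, ?_⟩
    rw [pairing_smul_xPlus_mulVec] at hz ⊢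
    have key := Valuation.map_sub_le _ hz (hdiff y hy)
    convert key using 2
    ring

end Summit.HodgeConjecture.HodgeConjecture.Cruxes.H413.F0P3cDyRamFrameEltOneSlotLabel

end
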